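import Mathlib
import Summits.Ventures.HodgeRepro2.Tier7.Target

/-!
# Tier7/Line3/Defs — LINE 3 (t7-plan-3): the two-torus relative trace formula on the seesaw partner — LANDED PART

TARGET: `P_T7` (Tier7/Target.lean, t7-lead). This file is the SORRY-FREE part of Line 3 (t7-lead l. 14635 (3),
landing path): the interface `SeesawData`, the per-datum statement `RtfConclusion`, the closed `Residual`, the
eighteen proved lemmas and the bridges. THE CERTIFICATE OF THE LINE is the PER-DATUM bridge
`exists_translates_of : RtfConclusion D → ∃ g, L2 (fOmegaS g) (fOmegaSbar g) ≠ 0` (proof uniform in `D`;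
t7-crit-1 l. 14643 (2) / t7-crit-2 l. 14647: a closed-form `Residual → P_T7` is provable by ex falso from the
datum of record and is therefore glue, not evidence). The one `sorry` of the line — `rtf_exists : Residual`,
refuted as a closed statement by the datum of record (t7-crit-1 l. 14643 (1)) and carrying the paper argument
(route/t7/L3-ARGUMENT.md §2–§4a) — stays in HOME/route/t7/Line3/Skeleton.lean and never lands.

STRATEGY (one sentence). Move the question to the SMALL group of the seesaw — `U(W_A)`, `W_A = W_{μ₀} ⊕ W_{μ₁}`
the 2-dimensional skew-hermitian space whose theta lift carries `θ(μ₀)∧θ(μ₁)` (and `W_B ≅ W_A` the one carrying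
`θ(μ₂)∧θ(μ₃)`), with the two NON-conjugate tori `T_A = U(W_{μ₀})×U(W_{μ₁})` and `T_B = U(W_{μ₂})×U(W_{μ₃})`
(conjugate under a similitude of multiplier `u ∉ N(E^×)`, not under `U(W_A)(F)`) — where (P) becomes «some
cuspidal `π ⊂ L²([U(W_A)])` has BOTH toric periods `∫_{[T_A]} φ μ_A ≠ 0`, `∫_{[T_B]} φ μ_B ≠ 0` and a non-zero theta
lift to `U(V)`»; produce that `π` by a SIMPLE TWO-TORUS RELATIVE TRACE FORMULA on the compact quotient (kernel
`K_f(x,y) = Σ_{γ∈U(W_A)(F)} f(x⁻¹γy)` integrated over `[T_A]×[T_B]` against `μ_A ⊠ μ̄_B`; geometric side = one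
regular double coset `T_A(F)γ₀T_B(F)` isolated by a small-support test function at an auxiliary inert place,
spectral side = `Σ_π Σ_φ P_A(R(f)φ) · conj P_B(φ)`, both sides finite — everything is compact); then come back
through the SEESAW (`θ(μ₀)∧θ(μ₁) = Θ_{W_A→V}(δ_{T_A,μ_A})`, Kudla 1984) and Rogawski's multiplicity one, and
finish with the POSITIVITY of the Hodge inner product on the common constituent.

WHY IT REACHES `P_T7`. `P_T7` quantifies over every period datum `D`; in the datum, the A-products
`D.fOmegaS g` and B-products `D.fOmegaSbar g` (all Hecke translates) span two Hecke submodules `𝒟_A`, `𝒟_B`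
of `H^{1,0}∧H^{1,0}`. The seesaw (L3.0, printed) writes every A-product inside `⨆_{π : P_A|π ≠ 0} Θ(π)` and every
B-product inside `⨆_{π : P_B|π ≠ 0} Θ(π)`, `Θ(π)` the `Θ(π)`-isotypic subspace (Hecke-irreducible by Howe duality
and (H10)). The RTF (L3.1) gives `π` with `P_A|π ≠ 0`, `P_B|π ≠ 0`, `Θ(π) ≠ 0`; the density lemmas (L3.2) give
`Θ(π) ≤ 𝒟_A` and `Θ(π) ≤ 𝒟_B`; L3.3 (PROVED) turns a non-zero common subspace of two spans into a non-orthogonal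
pair of spanning vectors, via `hr_pos`; the spanning vectors are pure products, so ONE `g : Fin 4 → G` does.

WHY NOT L1 / L2. L1 (t7-plan-1, l. 14489) lives on the Albanese: Hecke density + Hodge–Riemann / Künneth
non-degeneracy on `Alb X`; it never leaves `U(V)` and never decomposes anything spectrally. L2 (t7-plan-2,
l. 14513) unfolds the quadruple theta kernel on `U(V)` into rational orbits of 4-tuples in `V(F)^4` and isolates one
dominant orbit at deep level; it never uses the spectral side of anything and never sees the small group.
L3 does the opposite of both: it never expands a theta kernel over orbits of `V` and never touches the Albanese; its
device is a trace formula on `U(2)` whose geometric side is indexed by DOUBLE COSETS `T_A(F)\U(W_A)(F)/T_B(F)`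
(group elements, not vectors), and whose output is an automorphic representation with two toric periods. The only
step shared with L1 is the bookkeeping «translates of a non-zero vector span the irreducible component»
((H10); not L1's lever).

WHY NOVEL. The two-torus RTF for a pair of NON-conjugate tori `T_A, T_B` of `U(2)` with DIFFERENT characters,
run on a compact quotient to produce a representation distinguished by both, is not in the cell's record and not
in the printed theta-lift literature of these surfaces (BMM, Liu); the reference line reaches the same
representation through central L-values (Rallis inner product / Waldspurger), which L3 never forms.

§8(d): uses an L-value-free non-vanishing device: YES — the device (L3.1) is the geometric side of a relative
trace formula (orbital integrals, no L-function). One input of L3.2 is the Gan–Qiu–Takeda criterion for the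
non-vanishing of the GLOBAL theta lift `Θ_{W_A→V}(π)` (dim V = dim W_A + 1), whose analytic content is the EDGE
non-vanishing `L(1, π × χ_V) ≠ 0` (a theorem: Jacquet–Shalika / Shahidi / Hecke — not a central value, not a
computed value); it is flagged as such in L3.2's docstring.

SOURCES (printed; WANTED lines per README §9 are posted on STATUS.md): Kudla, «Seesaw dual reductive pairs»,
Automorphic forms of several variables (Katata 1983), Birkhäuser 1984 — the seesaw identity; Gelfand–Graev–
Piatetski-Shapiro, Representation theory and automorphic functions, ch. 1 §2 — spectral decomposition of
`L²(Γ\G)`, `Γ\G` compact (HELD with proof as Deitmar–Echterhoff, Principles of Harmonic Analysis, 2nd ed.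
2014, Thm 9.2.2, and quoted as Borel–Wallach VII 3.1 (2) — t7-lit-4, STATUS l. 14572); Howe, JAMS 2 (1989)
Thm 1 / Gan–Takeda, JAMS 29 (2016) Thm 1.1–1.2 (held; `Hyp.GanTakeda2016_Thm1_1/2` in Tier7/Lit4.lean) —
Howe duality; Rogawski, Automorphic representations of unitary groups in three variables, 1990, Thm 13.3.1 /
§14.6 — multiplicity one (with the inner-form caveat 14.6.4/14.6.5 of the lit index card C-L4-9); Gan–Qiu–Takeda,
«The regularized Siegel–Weil formula (the second term identity) and the Rallis inner product formula», Invent.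
Math. 198 (2014), Thm 1.3 / §11 — the non-vanishing criterion; Sun–Zhu, JAMS 28 (2015) — conservation relation;
Jacquet, «Sur un résultat de Waldspurger», Ann. Sci. ENS 19 (1986) — the relative trace formula with torus
periods (shape of the device only; the compact-quotient identity used here is DERIVED in route/t7/L3-ARGUMENT.md
§2); BMM arXiv 1306.1515 Cor 65 / Liu 2021 CJM Prop 4.13 — `θ(μ_i)` as theta lifts (= (H8)). The paper content
of the line's one `sorry` (`rtf_exists`, HOME only) is route/t7/L3-ARGUMENT.md (HOME), steps (i)–(iii).
-/

namespace Summit.Ventures.HodgeRepro2.Tier7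

open Summit.Ventures.HodgeRepro2.T6

noncomputable section

namespace Line3

variable {K : Type} [Field K] [NumberField K] {E' : Type} [Field E'] [NumberField E']
  {V : Type} [AddCommGroup V] [Module E' V] {HX : Type} [Ring HX] [Algebra ℂ HX]
  {G : Type} [Group G] [MulAction G HX]

/-! ## 1. The L² pairing of the shadow is sesquilinear and definite on `H^{1,0} ∧ H^{1,0}` (proved) -/

section L2
variable (S : SurfaceShadow HX G)

/-- `bar` sends `0` to `0` (from `bar_add`). -/
lemma bar_zero : S.bar 0 = 0 := by
  have h := S.bar_smul 0 0
  simpa using h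

/-- `L2` is additive in the first argument (`intX` additive). -/
lemma L2_add_left (a b c : HX) : S.L2 (a + b) c = S.L2 a c + S.L2 b c := by
  simp [SurfaceShadow.L2, add_mul, map_add]

/-- `L2` is ℂ-linear in the first argument (`intX` ℂ-linear). -/
lemma L2_smul_left (z : ℂ) (a c : HX) : S.L2 (z • a) c = z * S.L2 a c := by
  simp [SurfaceShadow.L2, map_smul, smul_eq_mul]

/-- `L2 0 c = 0`. -/
lemma L2_zero_left (c : HX) : S.L2 0 c = 0 := by
  simp [SurfaceShadow.L2]

/-- `L2` is additive in the second argument (`bar_add` + `intX` additive). -/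
lemma L2_add_right (a b c : HX) : S.L2 c (a + b) = S.L2 c a + S.L2 c b := by
  simp [SurfaceShadow.L2, S.bar_add, mul_add, map_add]

/-- `L2` is conjugate-linear in the second argument (`bar_smul` + `intX` ℂ-linear). -/
lemma L2_smul_right (z : ℂ) (a c : HX) : S.L2 c (z • a) = (starRingEnd ℂ z) * S.L2 c a := by
  simp [SurfaceShadow.L2, S.bar_smul, map_smul, smul_eq_mul]

/-- `L2 c 0 = 0`. -/
lemma L2_zero_right (c : HX) : S.L2 c 0 = 0 := by
  simp [SurfaceShadow.L2, bar_zero]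

/-- Orthogonality of two sets of vectors propagates to their spans (sesquilinearity of `L2`). -/
lemma L2_eq_zero_of_span (A B : Set HX) (h : ∀ a ∈ A, ∀ b ∈ B, S.L2 a b = 0) :
    ∀ x ∈ Submodule.span ℂ A, ∀ y ∈ Submodule.span ℂ B, S.L2 x y = 0 := by
  have hA : ∀ x ∈ Submodule.span ℂ A, ∀ b ∈ B, S.L2 x b = 0 := by
    intro x hx
    induction hx using Submodule.span_induction with
    | mem x hxA => intro b hb; exact h x hxA b hb
    | zero => intro b _; exact L2_zero_left S b
    | add x y _ _ ihx ihy => intro b hb; rw [L2_add_left, ihx b hb, ihy b hb, add_zero]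
    | smul z x _ ih => intro b hb; rw [L2_smul_left, ih b hb, mul_zero]
  intro x hx y hy
  induction hy using Submodule.span_induction with
  | mem y hyB => exact hA x hx y hyB
  | zero => exact L2_zero_right S x
  | add y y' _ _ ihy ihy' => rw [L2_add_right, ihy, ihy', add_zero]
  | smul z y _ ih => rw [L2_smul_right, ih, mul_zero]

/-- `L2 v v ≠ 0` for `0 ≠ v ∈ H^{1,0} ∧ H^{1,0}` — Hodge–Riemann, field `hr_pos`. -/
lemma L2_self_ne_zero (v : HX) (hv : v ∈ S.H10 * S.H10) (hne : v ≠ 0) : S.L2 v v ≠ 0 := by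
  intro h0
  have := S.hr_pos v hv hne
  rw [SurfaceShadow.L2] at h0
  rw [h0] at this
  simp at this

/-- **L3.3 (PROVED).** A non-zero subspace of `H^{1,0} ∧ H^{1,0}` contained in the spans of two sets of vectors
forces a pair of spanning vectors with non-zero L² pairing. -/
theorem exists_L2_ne_zero (A B : Set HX) (W : Submodule ℂ HX) (hW : W ≤ S.H10 * S.H10) (hne : W ≠ ⊥)
    (hA : W ≤ Submodule.span ℂ A) (hB : W ≤ Submodule.span ℂ B) :
    ∃ a ∈ A, ∃ b ∈ B, S.L2 a b ≠ 0 := by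
  by_contra hcon
  have hcon' : ∀ a ∈ A, ∀ b ∈ B, S.L2 a b = 0 := fun a ha b hb => by
    by_contra h
    exact hcon ⟨a, ha, b, hb, h⟩
  obtain ⟨v, hvW, hv⟩ := (Submodule.ne_bot_iff W).mp hne
  exact L2_self_ne_zero S v (hW hvW) hv (L2_eq_zero_of_span S A B hcon' v (hA hvW) v (hB hvW))

end L2

/-! ## 2. The seesaw carriers: the automorphic spectrum of the small group `U(W_A)` seen inside `H^{1,0}∧H^{1,0}` -/

variable (D : PeriodDatum K E' V HX G)

/-- `𝒟_A`: the span of all A-products `(g₀ • θ(μ₀)) ∧ (g₁ • θ(μ₁))` — the Hecke module generated by `f^*Ω_s`. -/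
def DA : Submodule ℂ HX := Submodule.span ℂ (Set.range D.fOmegaS)

/-- `𝒟_B`: the span of all B-products `(g₂ • θ(μ₂)) ∧ (g₃ • θ(μ₃))` — the Hecke module generated by `f^*Ω_{s̄}`. -/
def DB : Submodule ℂ HX := Submodule.span ℂ (Set.range D.fOmegaSbar)

/-- THE SEESAW CARRIERS (L3.0): the cuspidal automorphic representations `π` of the small group `U(W_A)` of the
seesaw (`Rep`; `[U(W_A)]` is compact, the spectrum discrete), the `Θ(π)`-isotypic subspace
`Θ π = (Θ(π)-isotypic part of H^{2,0}(X_∞)) ⊓ (H^{1,0}∧H^{1,0})` of the global theta lift `Θ_{W_A→V}(π)`, and the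
isotypic projections `comp π`. The Prop fields are PRINTED facts: Matsushima / Borel–Wallach VII Thm 3.2 (adelically
Liu 2021 App. D (D.1)) — `H^{2,0}(X_∞)` is the direct sum of its `Π_f`-isotypic parts, so the projections exist, are
Hecke-equivariant and preserve every Hecke submodule; Howe duality for `(U(W_A), U(V))` + Rogawski (H10) — a
non-zero isotypic part is Hecke-irreducible. The period predicates of the strategy («the `(T_A, μ_A)`-toric period is
non-zero on `π`») are NOT carried: in the shadow, «`Θ(π)` occurs in the A-products» is `∃ g, comp π (fOmegaS g) ≠ 0`,
which is what the seesaw identity (Kudla 1984) and the RTF deliver (L3.1). No field states a non-zero component, a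
common `π`, a period value, or an existential over translates; the square-zero model satisfies them with `Rep = Empty`. -/
structure SeesawData where
  Rep : Type
  Θ : Rep → Submodule ℂ HX
  comp : Rep → (HX →ₗ[ℂ] HX)
  /-- the isotypic subspaces are holomorphic 2-forms -/
  Θ_le : ∀ π, Θ π ≤ D.S.H10 * D.S.H10
  /-- Howe duality + (H10): a non-zero isotypic subspace is Hecke-irreducible -/
  Θ_irred : ∀ π, Θ π ≠ ⊥ → HeckeIrred G (Θ π)
  /-- `comp π` lands in `Θ π` -/
  comp_mem : ∀ π x, comp π x ∈ Θ π
  /-- the isotypic projections are Hecke-equivariant -/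
  comp_act : ∀ π (g : G) x, comp π (g • x) = g • comp π x
  /-- they preserve every Hecke submodule of `H^{1,0}∧H^{1,0}` (semisimplicity: a Hecke submodule is the direct
  sum of its isotypic parts) -/
  comp_preserves : ∀ π (U : Submodule ℂ HX), U ≤ D.S.H10 * D.S.H10 → HeckeStable G U →
    ∀ x ∈ U, comp π x ∈ U

/-- **L3.1 — THE TWO-TORUS RELATIVE TRACE FORMULA (the device; load-bearing; L-value-free) + the seesaw** — the
statement, per datum (the closed residual `Residual` below quantifies it over all data; the line's only `sorry`, `rtf_exists : Residual`, lives in HOME/route/t7/Line3/Skeleton.lean).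
STATEMENT IN WORDS: some cuspidal `π ⊂ L²([U(W_A)])` has a non-zero `Θ(π)`-component in SOME A-product and in SOME
B-product. PROOF STRATEGY (the line's own analysis; not in print for this configuration — WANTED lines on STATUS.md):
(i) RTF. For `f = ⊗_v f_v ∈ C_c^∞(U(W_A)(𝔸))`, integrating `K_f(x,y) = Σ_{γ ∈ U(W_A)(F)} f(x⁻¹γy)` over `[T_A] × [T_B]`
against `μ_A(x) · conj μ_B(y)` gives `Σ_{γ ∈ T_A(F)\U(W_A)(F)/T_B(F)} vol([Stab_γ]) ∏_v O_γ(f_v) = Σ_π Σ_{φ ∈ ONB(π)}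
P_A(R(f)φ) · conj P_B(φ)`, a finite identity (`[U(W_A)]`, `[T_A]`, `[T_B]` compact: `W_A` definite at `ι₁`, `E¹`
anisotropic). Take `f_v` = the projector / an integrable matrix coefficient of the prescribed local component at
`ι₁, ι₂, ι₃` and at `S_g` (the components whose theta lifts are the holomorphic (2,0)-discrete series at `ι₁`, the
`U(3)`-types of the definite Fock vectors at `ι₂, ι₃`, the packet members distinguished by both tori at `S_g`),
`1_{K_v}` outside `S`, and at one auxiliary inert place `v₁` a function supported near a regular `γ₀ ∈ U(W_A)(F)`,
small in the double-coset invariant `κ(γ₀) ∈ F`: the geometric side is the single term `vol · ∏_v O_{γ₀}(f_v)`,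
non-zero for `γ₀` in an open dense set (weak approximation; each local bi-period of a matrix coefficient is a non-zero
real-analytic function of `γ₀`). Hence some `π` with the prescribed components has `P_A|π ≠ 0` and `P_B|π ≠ 0`.
(ii) Theta. The local lifts of `π` to `V_v` are non-zero at every place — at the uncontrolled places because a `π_v`
with a non-zero local `(T_A, μ_A)`-period is not a lift from the wrong hermitian line (local seesaw + `(U(1),U(1))`
dichotomy; the vertex characters lift to the global line `V′`) — and the GLOBAL lift is non-zero by Gan–Qiu–Takeda
(Invent. 198 (2014) Thm 1.3, `dim V = dim W_A + 1`), whose analytic input is the EDGE value `L(1, π × χ_V) ≠ 0`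
(Jacquet–Shalika / Shahidi / Hecke: a theorem in print, not a central value). (iii) Seesaw. By Kudla 1984 every
A-product is `Θ_{Φ}(δ_{T_A,μ_A}) = Σ_{π'} Θ_Φ(v_{A,π'})` with `v_{A,π'}` the Riesz vector of `P_A|π'`; its `Θ(π)`-component
is `Θ_Φ(v_{A,π})`, non-zero for a suitable finite Schwartz datum (the kernel of `v ↦ Θ_·(v)` is a `U(W_A)(𝔸_f)`-submodule
of the irreducible `π`; the fixed archimedean (1,0)-Fock data do not kill the `T_A`-weight vector of `π_∞`: the explicit
Fock-model computation); a finite Schwartz datum is a Hecke translate `g`. Same for the B-side. -/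
def RtfConclusion : Prop :=
  ∃ sw : SeesawData D, ∃ π : sw.Rep,
    (∃ g : Fin 4 → G, sw.comp π (D.fOmegaS g) ≠ 0) ∧ (∃ g : Fin 4 → G, sw.comp π (D.fOmegaSbar g) ≠ 0)

/-! ### Hecke-stability of the product modules (proved) -/

/-- The Hecke action is additive, hence fixes `0`. -/
lemma act_zero (S : SurfaceShadow HX G) (g : G) : g • (0 : HX) = 0 := by
  have h := S.act_smul g 0 0
  simpa using h

/-- Each `theta g i = g i • alb (e i)` lies in `H10` (`alb_h10`, `e_mem`, `act_H10`). -/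
lemma theta_mem_H10 (g : Fin 4 → G) (i : Fin 4) : D.theta g i ∈ D.S.H10 :=
  D.S.act_H10 (g i) _ (D.omega_le i (D.theta_mem i))

/-- The A-product `fOmegaS g = theta g 0 * theta g 1` lies in `H10 * H10`. -/
lemma fOmegaS_mem (g : Fin 4 → G) : D.fOmegaS g ∈ D.S.H10 * D.S.H10 :=
  Submodule.mul_mem_mul (theta_mem_H10 D g 0) (theta_mem_H10 D g 1)

/-- The B-product `fOmegaSbar g = theta g 2 * theta g 3` lies in `H10 * H10`. -/
lemma fOmegaSbar_mem (g : Fin 4 → G) : D.fOmegaSbar g ∈ D.S.H10 * D.S.H10 :=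
  Submodule.mul_mem_mul (theta_mem_H10 D g 2) (theta_mem_H10 D g 3)

/-- Hecke translates of an A-product are A-products (`act_mul`, `act_smul`, `mul_smul`). -/
lemma act_fOmegaS (k : G) (g : Fin 4 → G) : k • D.fOmegaS g = D.fOmegaS (fun i => k * g i) := by
  simp [PeriodDatum.fOmegaS, PeriodDatum.theta, D.S.act_mul, mul_smul]

/-- Hecke translates of a B-product are B-products (`act_mul`, `act_smul`, `mul_smul`). -/
lemma act_fOmegaSbar (k : G) (g : Fin 4 → G) : k • D.fOmegaSbar g = D.fOmegaSbar (fun i => k * g i) := by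
  simp [PeriodDatum.fOmegaSbar, PeriodDatum.theta, D.S.act_mul, mul_smul]

/-- The span `DA` of the A-products lies in `H10 * H10`. -/
lemma DA_le : DA D ≤ D.S.H10 * D.S.H10 := by
  rw [DA, Submodule.span_le]
  rintro _ ⟨g, rfl⟩
  exact fOmegaS_mem D g

/-- The span `DB` of the B-products lies in `H10 * H10`. -/
lemma DB_le : DB D ≤ D.S.H10 * D.S.H10 := by
  rw [DB, Submodule.span_le]
  rintro _ ⟨g, rfl⟩
  exact fOmegaSbar_mem D g

/-- `DA` is Hecke-stable (`act_fOmegaS` + additivity and ℂ-linearity of the action on spans). -/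
lemma DA_stable : HeckeStable G (DA D) := by
  intro k a ha
  induction ha using Submodule.span_induction with
  | mem x hx =>
    obtain ⟨g, rfl⟩ := hx
    rw [act_fOmegaS]
    exact Submodule.subset_span ⟨_, rfl⟩
  | zero => rw [act_zero D.S]; exact Submodule.zero_mem _
  | add x y _ _ ihx ihy => rw [D.S.act_add]; exact Submodule.add_mem _ ihx ihy
  | smul z x _ ih => rw [D.S.act_smul]; exact Submodule.smul_mem _ z ih

/-- `DB` is Hecke-stable (`act_fOmegaSbar` + additivity and ℂ-linearity of the action on spans). -/
lemma DB_stable : HeckeStable G (DB D) := by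
  intro k a ha
  induction ha using Submodule.span_induction with
  | mem x hx =>
    obtain ⟨g, rfl⟩ := hx
    rw [act_fOmegaSbar]
    exact Submodule.subset_span ⟨_, rfl⟩
  | zero => rw [act_zero D.S]; exact Submodule.zero_mem _
  | add x y _ _ ihx ihy => rw [D.S.act_add]; exact Submodule.add_mem _ ihx ihy
  | smul z x _ ih => rw [D.S.act_smul]; exact Submodule.smul_mem _ z ih

/-- **L3.2 (PROVED) — DENSITY.** If the `Θ(π)`-component of some element of a Hecke submodule `U` of
`H^{1,0}∧H^{1,0}` is non-zero, then `Θ π ≤ U`: the image `comp π (U)` is a non-zero Hecke submodule of the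
Hecke-irreducible `Θ π` contained in `U` (semisimplicity), hence equal to `Θ π`. Applied to `U = 𝒟_A`, `𝒟_B`. -/
theorem density (sw : SeesawData D) (π : sw.Rep) (U : Submodule ℂ HX) (hU : U ≤ D.S.H10 * D.S.H10)
    (hst : HeckeStable G U) (h : ∃ x ∈ U, sw.comp π x ≠ 0) : sw.Θ π ≤ U := by
  obtain ⟨x, hxU, hx⟩ := h
  have hne : sw.Θ π ≠ ⊥ := by
    intro hbot
    have := sw.comp_mem π x
    rw [hbot, Submodule.mem_bot] at this
    exact hx this
  obtain ⟨_, _, hirr⟩ := sw.Θ_irred π hne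
  set W : Submodule ℂ HX := (U.map (sw.comp π)) ⊓ sw.Θ π with hWdef
  have hWle : W ≤ sw.Θ π := inf_le_right
  have hWst : HeckeStable G W := by
    intro g a ha
    rw [Submodule.mem_inf] at ha ⊢
    obtain ⟨⟨y, hyU, rfl⟩, _⟩ := ha
    refine ⟨⟨g • y, hst g y hyU, sw.comp_act π g y⟩, ?_⟩
    rw [← sw.comp_act]
    exact sw.comp_mem π _
  rcases hirr W hWle hWst with hW | hW
  · exfalso
    have hmem : sw.comp π x ∈ W := Submodule.mem_inf.mpr ⟨⟨x, hxU, rfl⟩, sw.comp_mem π x⟩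
    rw [hW, Submodule.mem_bot] at hmem
    exact hx hmem
  · rw [← hW]
    intro a ha
    rw [Submodule.mem_inf] at ha
    obtain ⟨⟨y, hyU, rfl⟩, _⟩ := ha
    exact sw.comp_preserves π U hU hst y hyU

/-! ## 3. Glue (proved) -/

/-- `f^*Ω_s` depends only on the first two translates. -/
lemma fOmegaS_congr (g g' : Fin 4 → G) (h0 : g 0 = g' 0) (h1 : g 1 = g' 1) :
    D.fOmegaS g = D.fOmegaS g' := by
  simp [PeriodDatum.fOmegaS, PeriodDatum.theta, h0, h1]

/-- `f^*Ω_{s̄}` depends only on the last two translates. -/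
lemma fOmegaSbar_congr (g g' : Fin 4 → G) (h2 : g 2 = g' 2) (h3 : g 3 = g' 3) :
    D.fOmegaSbar g = D.fOmegaSbar g' := by
  simp [PeriodDatum.fOmegaSbar, PeriodDatum.theta, h2, h3]

/-- **L3.4 (PROVED)** — the line's conclusion for one datum FROM L3.1 (as a hypothesis) and L3.2–L3.3: the
kernel-checked bridge «residual ⇒ conclusion» (sorry-free). -/
theorem exists_translates_of (h : RtfConclusion D) :
    ∃ g : Fin 4 → G, D.S.L2 (D.fOmegaS g) (D.fOmegaSbar g) ≠ 0 := by
  obtain ⟨sw, π, ⟨gA, hgA⟩, ⟨gB, hgB⟩⟩ := h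
  have hA : sw.Θ π ≤ DA D :=
    density D sw π (DA D) (DA_le D) (DA_stable D) ⟨_, Submodule.subset_span ⟨gA, rfl⟩, hgA⟩
  have hB : sw.Θ π ≤ DB D :=
    density D sw π (DB D) (DB_le D) (DB_stable D) ⟨_, Submodule.subset_span ⟨gB, rfl⟩, hgB⟩
  have hne : sw.Θ π ≠ ⊥ := by
    intro hbot
    have := sw.comp_mem π (D.fOmegaS gA)
    rw [hbot, Submodule.mem_bot] at this
    exact hgA this
  obtain ⟨a, ha, b, hb, hab⟩ :=
    exists_L2_ne_zero D.S (Set.range D.fOmegaS) (Set.range D.fOmegaSbar) (sw.Θ π) (sw.Θ_le π) hne hA hB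
  obtain ⟨g, rfl⟩ := ha
  obtain ⟨g', rfl⟩ := hb
  refine ⟨![g 0, g 1, g' 2, g' 3], ?_⟩
  rw [fOmegaS_congr D ![g 0, g 1, g' 2, g' 3] g (by rfl) (by rfl),
    fOmegaSbar_congr D ![g 0, g 1, g' 2, g' 3] g' (by rfl) (by rfl)]
  exact hab

end Line3

namespace Line3

/-- **THE RESIDUAL OF LINE 3** (closed statement, quantified exactly as `P_T7`): every datum has the RTF/seesaw
conclusion `RtfConclusion` — some isotypic projection of the displayed interface `SeesawData` is non-zero on some
pure A-product and on some pure B-product. TWO-SIDED RESIDUAL TEST (t7-lead FROZEN line, crit-2 riders (iii)/(iv)):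
(a) `Residual → P_T7` is `p_T7_of_residual` below, sorry-free, and USES the fields (`hr_pos` through
`L2_self_ne_zero`, `act_mul`/`act_smul`/`act_add` through `DA_stable`/`DB_stable`, `Θ_irred` through `density`) —
not logic alone; (b) it FAILS in the square-zero datum (there `P_T7` fails, crit-1's counter-model, and
`Residual → P_T7`); (c) whether `P_T7 → Residual` over the abstract datum is OPEN: the construction of an equivariant
`comp π : HX →ₗ[ℂ] HX` from the conclusion needs a Hecke-stable retraction `HX → H10 * H10` or a finite-dimensional
`Θ π` (for an `L2`-orthogonal projection), neither of which is a field — no derivation and no separating datum is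
recorded (t7-plan-3, STATUS; the real objects satisfy both directions, as README §11 (2) expects of the step's shadow). -/
def Residual : Prop :=
  ∀ (K : Type) [Field K] [NumberField K] (E' : Type) [Field E'] [NumberField E']
    (V : Type) [AddCommGroup V] [Module E' V] (HX : Type) [Ring HX] [Algebra ℂ HX]
    (G : Type) [Group G] [MulAction G HX] (D : PeriodDatum K E' V HX G), RtfConclusion D

/-- The closed-form glue `Residual → P_T7` (crit-2 rider (iv) shape), sorry-free and uniform in the datum — it is
`exists_translates_of` applied pointwise. It is NOT the certificate of the line (t7-crit-1 l. 14643 (2): the datum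
of record refutes `Residual`, so this implication is also provable by ex falso); the certificate is the per-datum
bridge `exists_translates_of`. Kept as glue: `P_T7` follows from the HOME-only `rtf_exists : Residual` by
`p_T7_of_residual rtf_exists` (HOME/route/t7/Line3/Skeleton.lean, `target_L3`). -/
theorem p_T7_of_residual (h : Residual) : P_T7 := by
  intro K _ _ E' _ _ V _ _ HX _ _ G _ _ D
  exact exists_translates_of D (h K E' V HX G D)

end Line3

end

end Summit.Ventures.HodgeRepro2.Tier7
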